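import Mathlib.Data.Finset.Powerset
import Mathlib.Data.Fintype.Powerset
import Mathlib.Algebra.BigOperators.Group.Finset.Basic
import Mathlib.Algebra.Order.BigOperators.Group.Finset
import HarnessLib
import HarnessLib.Audit.Tags

/-!
# `NoHeavyLowerTail` (crux stmt-CriticalPhenomena-4575), master-family line P1 (gen 23):
# the SWITCH-FACTORED (SPLIT) comb conjecture behind S₃^max — typed

Support file (seat `prim-masterthm-p1`, gen 23; `--supports stmt-CriticalPhenomena-4575`).  Definitions + one typed conjecture; standard
axioms, no `sorry`.  Memo `run/shared/lean/prim/prim-masterthm/FROM-prim-masterthm-p1-g23-SWITCH-FACTORED-COMB.md`.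

SETTING (as `SunflowerPartition.…` of `…SunflowerAntipodalGladkov`, seat prim-ineq-prove-1): a 3-petal sunflower system on the cube
`Finset (Fin n)` is a labelling `lab : Finset (Fin n) → Fin 5` monotone for the diamond order of `M₃` coded on `Fin 5` (`0` = outside
`O` (bottom), `1,2,3` = the petals `C₁,C₂,C₃`, `4` = the kernel `K` (top); `a ≤ b ⟺ a = b ∨ a = 0 ∨ b = 4`), `IsM3Monotone`.  The
`r`-COPY FIBRE of an `r`-tuple of points is the digit vector `e ↦ #{copies containing e}`; fibre COUNTS are the tensor–Bernstein
coefficients: for the product measure with biases `p`, `μ^{⊗r}(A) = Σ_m #(A ∩ fibre m) · Π_e p_e^{m_e} (1−p_e)^{r−m_e}`.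

THE CONJECTURE (SPLIT) (`SwitchFactoredSplit`; census-certified EXACTLY for every system on `n ≤ 5` coins — 21 123 474 systems —
and closed under monotone block composition; memo §0–§4).  Let `G(a) := #{(y,x) ∈ K×O : fibre = a} − Σ_{i<j} #{(c,c') ∈ C_i×C_j : fibre = a}`
(`gladkovSurplus`; `G ≥ 0` is the antipodal form of Gladkov's `κo ≥ e₂`, a kernel theorem of prim-ineq-prove-1).  **(SPLIT): there are
`P, Q ≥ 0` on 2-copy fibres with `P + Q = G` such that for every 3-copy fibre `m` the number of RAINBOWS `(c₁,c₂,c₃) ∈ C₁×C₂×C₃` in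
fibre `m` is at most `Σ_{x ∈ O} P(m − 1_x) + Σ_{y ∈ K} Q(m − 1_y)`** (`SplitCertificate`).  Evaluating the polynomial identity
`K̂²E − Û₁Û₂Û₃ = [K̂·Q + Ô·P − ê₃] + (K̂ − Ô)·P` at `z = p/(1−p)` gives the kernel branch of S₃^max (`Π μ(U_i) ≤ μ(K)²` whenever
`μ(K) ≥ μ(O)`), and `ÔG − ê₃ = [same] + (Ô − K̂)·Q` the outside branch — so (SPLIT) ⟹ `SahiDeepCore.StrongCubicMaxNonneg` ⟹ S₃⁺ ⟹ S₃ ⟹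
the class law (memo §1; the measure bridge is not formalised in this file).
HONEST FRAMING: typed conjecture only; nothing is proved here about it or about the crux. [this work]
-/

namespace Summit.CriticalPhenomena.PercolationContinuityZ3.Theorems

namespace SahiSwitchFactored

open Finset

variable {n : ℕ}

/-- Monotonicity for the diamond order of `M₃` on `Fin 5` (`0` bottom, `4` top, `1,2,3` pairwise incomparable): the labelling is a
3-petal sunflower system (kernel `4`, petals `1,2,3`, outside `0`; empty cells allowed). [this work] -/
def IsM3Monotone (lab : Finset (Fin n) → Fin 5) : Prop :=
  ∀ x y : Finset (Fin n), x ⊆ y → (lab x = lab y ∨ lab x = 0 ∨ lab y = 4)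

/-- The cell with label `c`. [this work] -/
def cell (lab : Finset (Fin n) → Fin 5) (c : Fin 5) : Finset (Finset (Fin n)) :=
  univ.filter fun x => lab x = c

/-- The 2-copy fibre (digit vector) of a pair of points. [this work] -/
def pairFibre (x y : Finset (Fin n)) : Fin n → ℕ :=
  fun e => (if e ∈ x then 1 else 0) + (if e ∈ y then 1 else 0)

/-- The 3-copy fibre of a triple of points. [this work] -/
def tripleFibre (x y w : Finset (Fin n)) : Fin n → ℕ :=
  fun e => (if e ∈ x then 1 else 0) + (if e ∈ y then 1 else 0) + (if e ∈ w then 1 else 0)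

/-- Number of pairs in `S × T` with 2-copy fibre `a`. [this work] -/
def pairCount (S T : Finset (Finset (Fin n))) (a : Fin n → ℕ) : ℕ :=
  ((S ×ˢ T).filter fun q => pairFibre q.1 q.2 = a).card

/-- Number of triples in `S × T × W` with 3-copy fibre `m`. [this work] -/
def tripleCount (S T W : Finset (Finset (Fin n))) (m : Fin n → ℕ) : ℕ :=
  ((S ×ˢ T ×ˢ W).filter fun q => tripleFibre q.1 q.2.1 q.2.2 = m).card

/-- The comb (2-copy, antipodal) surplus of Gladkov's inequality at the fibre `a`:
`#(K × O)(a) − Σ_{i<j} #(C_i × C_j)(a)`. [this work] -/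
def gladkovSurplus (lab : Finset (Fin n) → Fin 5) (a : Fin n → ℕ) : ℤ :=
  (pairCount (cell lab 4) (cell lab 0) a : ℤ)
    - (pairCount (cell lab 1) (cell lab 2) a + pairCount (cell lab 1) (cell lab 3) a + pairCount (cell lab 2) (cell lab 3) a : ℕ)

/-- Number of RAINBOWS `(c₁,c₂,c₃) ∈ C₁ × C₂ × C₃` in the 3-copy fibre `m` (the coefficient of `ê₃`). [this work] -/
def rainbowCount (lab : Finset (Fin n) → Fin 5) (m : Fin n → ℕ) : ℕ :=
  tripleCount (cell lab 1) (cell lab 2) (cell lab 3) m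

/-- `Σ_{x ∈ X} F(m − 1_x)` over the points `x ∈ X` with `1_x ≤ m` (the coefficient at `m` of `X̂ · F`). [this work] -/
def shiftCount (X : Finset (Finset (Fin n))) (F : (Fin n → ℕ) → ℕ) (m : Fin n → ℕ) : ℕ :=
  ∑ x ∈ X, if (∀ e ∈ x, 1 ≤ m e) then F (fun e => if e ∈ x then m e - 1 else m e) else 0

/-- `(P, Q)` is a SPLIT CERTIFICATE of the system `lab`: `P + Q = G` on every 2-copy fibre (so `P = Q = 0` off the genuine fibres,
where `G = 0`), and every rainbow fibre count is dominated by outside-shifts of `P` plus kernel-shifts of `Q`: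
`ê₃ ≼ Ô·P + K̂·Q`. [this work] -/
def SplitCertificate (lab : Finset (Fin n) → Fin 5) (P Q : (Fin n → ℕ) → ℕ) : Prop :=
  (∀ a, (P a : ℤ) + (Q a : ℤ) = gladkovSurplus lab a) ∧
    ∀ m, rainbowCount lab m ≤ shiftCount (cell lab 0) P m + shiftCount (cell lab 4) Q m

/-- **CONJECTURE (SPLIT; the switch-factored comb form of S₃^max).**  Every 3-petal sunflower system on every finite cube has a
split certificate.  Census (gen 23, exact integer arithmetic): all 21 123 474 systems on `≤ 5` coins; random systems on `6–8` coins;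
closed under monotone block composition (memo §4); its one-coordinate inductive step is LP-feasible in every test (memo §6).
[this work] [status: open] -/
@[conjecture] def SwitchFactoredSplit : Prop :=
  ∀ (n : ℕ) (lab : Finset (Fin n) → Fin 5), IsM3Monotone lab → ∃ P Q : (Fin n → ℕ) → ℕ, SplitCertificate lab P Q

end SahiSwitchFactored

end Summit.CriticalPhenomena.PercolationContinuityZ3.Theorems
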